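/-
Origin: expansion seat `prover-pub-hodgecm-mc-binder-2-g6-0`, handover #4 11:50Z md5 4a84562108f7 (127 l.; imports PKG `Model/WmInstance` + twins `Weil1964/ArchVacuumSectionPlaces` (F8), `ArchFockSpan` (D2); raw printed insertion `insRaw`, `insRaw_smul_left`) (`HOME/mc/pub-hodgecm-mc-binder-2/g6/pkg/HodgeCM/Model/HypCensus/InsRaw.lean`, md5 4a845621, 127 lines);
landed by the gen-12 packager (p-g12) in gate run 36 as `HodgeCM/Model/HypCensus/InsRaw.lean` (verbatim).
-/
/-
Origin: speedrun cell pub-hodgecm, MODEL-CONSTRUCTION sub-cell, lineage mc-binder-2 (rows A12/A34: `hyp12` / `hyp34`),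
seat prover-pub-hodgecm-mc-binder-2-g6-0 (gen 6), 2026-08-19.  Target in PKG: `HodgeCM/Model/HypCensus/InsRaw.lean`
(NEW additive leaf; RUN 36+, after K-1).  KERNEL only: definitions + `rfl`/`simp`-grade lemmas, 0 records, 0 proof holes.
-/
import Literature.Analysis.SegalBargmann.FockPlaceSubstitution
import Literature.NumberTheory.Weil1964.ArchFollandCompactKType
import Literature.NumberTheory.Automorphic.AdelicSchwartzBruhatTensor

/-!
# Census kit (rows A12/A34), file (J-ins)₀: the RAW printed insertion `⨂_w M_w → 𝒮(𝔸_F^{Fin 6})`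

The `ins` field of `ArchC.HypSmoothSide` (PKG `PerL34/ArchCHyperbolicSide`) sends a printed Fock vector
`φ ∈ ⨂_w 𝓕^{κ_w}_w` (pv12's printed local models, indexed by the infinite places `w` of the CM field) and a finite
Schwartz–Bruhat datum `Φ_f` to the adelic Schwartz function `E(follandFock e (∏_v emb_v φ_v) ⊗ Φ_f)`.  This file builds
that map as a `ℂ`-LINEAR map into `𝒮(𝔸_F^{Fin 6})` for ANY real frame `e` of the archimedean space, ANY place
re-indexing `eP : RP ≃ o` and ANY family of per-place linear embeddings `emb_w : M_w →ₗ ℂ[z_{Fin 6}]` — the typing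
`insRaw … φ ∈ SK` (the `κ`-isotypy) is the business of `HypCensus/Ins.lean` (junctions (J-arch), (J-plc), (J-x₀) of
BINDER-TRIAGE §48).

* `follandFockₗ e` — D2's `follandFock e : ℂ[z_σ] → 𝓢(D)` as a linear map (`follandFock_add/_smul`);
* `tmulRightₗ Φ_f` — `Φ_∞ ↦ Φ_∞ ⊗ₜ Φ_f`;
* **`insRaw F e eP emb Φ_f : (⨂[ℂ] w, M w) →ₗ[ℂ] piSchwartzBruhat F (Fin 6)`** and its value on pure tensors
  `insRaw_tprod : insRaw … (⨂ₜ w, m w) = E (follandFock e (∏_v rename (·, v) (emb (eP⁻¹ v) (m (eP⁻¹ v)))) ⊗ₜ Φ_f)`;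
* `insRaw_mem_range` — the archimedean polynomial of every value lies in `range (placeTensorIns emb')`, the
  hypothesis shape of F8 `forall_blockDiagonal_of_mem_range_placeTensorIns` (the `K_∞`-equations place by place).

Inputs (tree, vendored): F8 `SegalBargmann/FockPlaceSubstitution` §4 (`placeTensorIns`, `placeTensorIns_tprod`),
D2 `Weil1964/ArchFollandCompactKType` §1 (`follandFock`), `Automorphic/AdelicSchwartzBruhatTensor`
(`piSchwartzBruhatEquiv`, `FinSB`).  Nothing here is a claim of PerL/QW8.
-/

set_option autoImplicit false

noncomputable section

open scoped TensorProduct Classical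
open SchwartzMap MvPolynomial NumberField NumberField.mixedEmbedding
open Literature.Analysis.SegalBargmann Literature.NumberTheory.Weil1964 Literature.NumberTheory.Automorphic
open Literature.RepresentationTheory (atPlace)

namespace HodgeCM.Model.HypCensus

/-! ## §1 Linear packaging of the two tree maps -/

section Generic

variable {σ : Type*} [Fintype σ] [DecidableEq σ] {D : Type*} [NormedAddCommGroup D] [NormedSpace ℝ D]

/-- D2's `follandFock e` (`F ↦ (e^*)⁻¹ (B⁻¹ F)`) as a `ℂ`-linear map `ℂ[z_σ] →ₗ 𝓢(D)`. -/
def follandFockₗ (e : D ≃L[ℝ] (σ → ℝ)) : MvPolynomial σ ℂ →ₗ[ℂ] 𝓢(D, ℂ) where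
  toFun := follandFock e
  map_add' := follandFock_add e
  map_smul' := follandFock_smul e

/-- (Ported verbatim from the HodgeCMPerL package; no docstring in the source.) -/
@[simp] theorem follandFockₗ_apply (e : D ≃L[ℝ] (σ → ℝ)) (F : MvPolynomial σ ℂ) :
    follandFockₗ e F = follandFock e F := rfl

end Generic

section Adelic

variable (F : Type) [Field F] [NumberField F] (ι : Type) [Fintype ι]

/-- `Φ_∞ ↦ Φ_∞ ⊗ₜ Φ_f` as a linear map into the algebraic tensor product. -/
def tmulRightₗ (Φf : FinSB F ι) : 𝓢((ι → mixedSpace F), ℂ) →ₗ[ℂ] 𝓢((ι → mixedSpace F), ℂ) ⊗[ℂ] FinSB F ι :=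
  (TensorProduct.mk ℂ (𝓢((ι → mixedSpace F), ℂ)) (FinSB F ι)).flip Φf

/-- (Ported verbatim from the HodgeCMPerL package; no docstring in the source.) -/
@[simp] theorem tmulRightₗ_apply (Φf : FinSB F ι) (Φ : 𝓢((ι → mixedSpace F), ℂ)) :
    tmulRightₗ F ι Φf Φ = Φ ⊗ₜ Φf := rfl

end Adelic

/-! ## §2 The raw insertion -/

section Ins

variable (F : Type) [Field F] [NumberField F]
variable {RP : Type} {o : Type} [Fintype o] [DecidableEq o]
variable (e : (Fin 6 → mixedSpace F) ≃L[ℝ] ((Fin 6 × o) → ℝ)) (eP : RP ≃ o)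
variable {M : RP → Type} [∀ w, AddCommGroup (M w)] [∀ w, Module ℂ (M w)]
variable (emb : ∀ w, M w →ₗ[ℂ] MvPolynomial (Fin 6) ℂ) (Φf : FinSB F (Fin 6))

/-- the per-place embeddings re-indexed along `eP : RP ≃ o`. -/
def embAt (v : o) : M (eP.symm v) →ₗ[ℂ] MvPolynomial (Fin 6) ℂ := emb (eP.symm v)

/-- **The raw printed insertion** `φ ↦ E(follandFock e (placeTensorIns emb' (reindex φ)) ⊗ Φ_f)`:
`(⨂[ℂ] w, M w) →ₗ[ℂ] 𝒮(𝔸_F^{Fin 6})`. -/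
def insRaw : (⨂[ℂ] w, M w) →ₗ[ℂ] ↥(piSchwartzBruhat F (Fin 6)) :=
  (piSchwartzBruhatEquiv F (Fin 6)).toLinearMap ∘ₗ tmulRightₗ F (Fin 6) Φf ∘ₗ follandFockₗ e ∘ₗ
    placeTensorIns (κ := Fin 6) (o := o) (embAt eP emb) ∘ₗ
      (PiTensorProduct.reindex ℂ M eP).toLinearMap

/-- the archimedean Fock polynomial of a printed vector. -/
def insPoly : (⨂[ℂ] w, M w) →ₗ[ℂ] MvPolynomial (Fin 6 × o) ℂ :=
  placeTensorIns (κ := Fin 6) (o := o) (embAt eP emb) ∘ₗ (PiTensorProduct.reindex ℂ M eP).toLinearMap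

/-- (Ported verbatim from the HodgeCMPerL package; no docstring in the source.) -/
theorem insRaw_apply (φ : ⨂[ℂ] w, M w) :
    insRaw F e eP emb Φf φ = piSchwartzBruhatEquiv F (Fin 6) (follandFock e (insPoly eP emb φ) ⊗ₜ Φf) := rfl

omit [DecidableEq o] in
/-- every archimedean polynomial of the insertion lies in the range of F8's `placeTensorIns` (the hypothesis of
`forall_blockDiagonal_of_mem_range_placeTensorIns`). -/
theorem insPoly_mem_range (φ : ⨂[ℂ] w, M w) :
    insPoly eP emb φ ∈ LinearMap.range (placeTensorIns (κ := Fin 6) (o := o) (embAt eP emb)) :=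
  ⟨_, rfl⟩

omit [DecidableEq o] in
/-- **value on pure tensors**: the place product of the embedded local vectors. -/
theorem insPoly_tprod (m : ∀ w, M w) :
    insPoly eP emb (PiTensorProduct.tprod ℂ m) =
      ∏ v, rename (atPlace v) (emb (eP.symm v) (m (eP.symm v))) := by
  rw [insPoly, LinearMap.comp_apply, LinearEquiv.coe_toLinearMap, PiTensorProduct.reindex_tprod,
    placeTensorIns_tprod]
  rfl

/-- (Ported verbatim from the HodgeCMPerL package; no docstring in the source.) -/
theorem insRaw_tprod (m : ∀ w, M w) :
    insRaw F e eP emb Φf (PiTensorProduct.tprod ℂ m) =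
      piSchwartzBruhatEquiv F (Fin 6)
        (follandFock e (∏ v, rename (atPlace v) (emb (eP.symm v) (m (eP.symm v)))) ⊗ₜ Φf) := by
  rw [insRaw_apply, insPoly_tprod]

end Ins

end HodgeCM.Model.HypCensus

end
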